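import Summits.QuantumFields.YangMills.Theorems.BalabanLadderUVSeamRecCeilingsPolymerRarityMoments
import Summits.QuantumFields.YangMills.Theorems.BalabanLadderIROddTorusLargeFieldRaritySharp
import Literature.MathematicalPhysics.QuantumFieldTheory.QuasiLocalGaugePerturbationWilson
import Literature.MathematicalPhysics.QuantumLattice.LatticeGaugeDLRFreeEnergyProofs
import Literature.Probability.LatticeModels.XYTorusFreeBoxComparison
import HarnessLib

/-!
# Crux `UVSeamRec` (stmt-QuantumFields-20043), stub `stub_ceilings` (E0′): the SCALE-ZERO instance of the polymer law
# (PL) is a theorem on EVERY odd torus — large plaquettes form a Peierls gas of activity `e^{−βε/6}·β^{D₁/6}·e^{K₀/6}`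

Helper file (`--supports stmt-QuantumFields-20043`) of the width-lever seat `ym-20043-ceilings-p2` (lane B); sequel of
`…CeilingsPolymerRarity.lean` (p527372), `…CeilingsPolymerRarityMoments.lean` (p528131: `MomentBounds6 G r a` from a
tempered centre law + the polymer law (PL)) and `…Suppliers.lean`.  HONEST FRAMING: the theorems below are
UNCONDITIONAL but concern the PLAQUETTE scale only; the polymer law the ceilings need is its MULTISCALE analogue for
block-averaged fields (Bałaban's large-field regions), which is open on odd tori.  Moreover the scale-zero tempered
centre law that §3 would pair with is presumably FALSE for the same reason as `FBL6` (coherently fluxed exteriors with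
all plaquettes small penetrate: lead ym-spine-20043-p1 g7, `…UVSeamRecPenetrationDefs`; seam-s2 note §2).  So this file
shows that clause (iv) of (PL) has exactly the SHAPE the tree's Peierls–chessboard machinery outputs, on all odd sides
(primes included: at the plaquette scale the divisibility obstruction of the block chessboard is void), and nothing
more.  Not E0′, not a gap, not Clay.

* §1 `productLaw_largePlaquettes` — for every lattice representation `r` there are `K₀, D₁` with: on every odd torus
  `(ℤ/M)⁴`, `M ≥ 3`, at `β ≥ 1`, for every threshold `ε` and every finite set `A` of torus plaquettes,
  `μ_{M,β}(⋂_{p∈A} {ε ≤ φ_p}) ≤ ∏_{p∈A} δ(β,ε)`, `δ(β,ε) = exp(−βε/m + (K₀ + D₁ log β)/m)`, `m = #orientations = 6` —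
  infvol-p3's sharp hereditary rarity `measureReal_forall_le_cellAction_le_pow_rep_sharp` at singleton cells.
* §2 `measureReal_biInter_plaquetteInfluence_le_pow` — hence every family of LINEAR PLAQUETTE-INFLUENCE functionals
  `I_i = Σ_p c_{ip} 1[ε ≤ φ_p]` (`c ≥ 0`, `Σ_i c_{ip} ≤ Λ`, `Σ_p c_{ip} δ ≤ W`) has multiplicatively rare super-level sets,
  `μ(⋂_{i∈T} {θ ≤ I_i}) ≤ exp(λ e^{λΛ} W − λθ)^{#T}`, on every odd torus — p527372's
  `measureReal_biInter_le_pow_of_polymerLaw` with (PL) DISCHARGED.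
* §3 `torusE_prod_indicator_largePlaquetteZd_le` — the same product law in the LIFTED vocabulary of the route
  (clause (iv) of `PolymerRarity.rarity_of_polymerLaw` verbatim, polymer index `ZdPlaquette 4`, events
  `E_q = {η | ε ≤ N − Re tr r(η_{∂q})}`, plaquettes based in the fundamental box `[−L, L]⁴` of the torus `2L+1`).

References: J. Fröhlich, R. Israel, E. H. Lieb, B. Simon, Commun. Math. Phys. 62 (1978) Thm. 4.1, §5 (Peierls–chessboard;
the tree's `…IROddTorusLargeFieldRaritySharp`); R. Kotecký, D. Preiss, Commun. Math. Phys. 103 (1986) 491–498.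
-/

set_option autoImplicit false

noncomputable section

open MeasureTheory Filter Topology Finset
open Literature.Probability.LatticeModels
open Literature.MathematicalPhysics.QuantumFieldTheory (GaugeConfig wilsonMeasure isProbabilityMeasure_wilsonMeasure
  measurable_torusLift LatticeRep Plaquette plaquetteCost measurable_plaquetteCost)
open Literature.MathematicalPhysics.QuantumLattice
open Summit.QuantumFields.YangMills.Cruxes.UVSeamRec.DefectCollar (integral_prod_indicator_eq_measureReal)
open Summit.QuantumFields.YangMills.Theorems.OddTorusChessboard (Orient measureReal_forall_le_cellAction_le_pow_rep_sharp)

namespace Summit.QuantumFields.YangMills.Cruxes.UVSeamRec.PolymerRarity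

open Summit.QuantumFields.YangMills.Cruxes.OSLegsFromFemtoAndGap.DlrCollarTransfer

section PlaquetteScale

variable {G : Type} [Group G] [TopologicalSpace G] [IsTopologicalGroup G] [CompactSpace G]
  [MeasurableSpace G] [BorelSpace G]

/-! ## §1 The Peierls product law of the large-plaquette gas on every odd torus -/

/-- **The large plaquettes of the Wilson state on an odd four-torus form a Peierls gas.**  For every lattice
representation `r` there are constants `K₀ : ℝ`, `D₁ : ℕ` such that on every odd torus `(ℤ/M)⁴` with `M ≥ 3`, at every
`β ≥ 1`, for every threshold `ε` and every finite set `A` of torus plaquettes,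
`μ_{M,β}(⋂_{p∈A} {U | ε ≤ φ_p(U)}) ≤ ∏_{p∈A} exp(−βε/m + (K₀ + D₁ log β)/m)` (`φ_p = N − Re tr r(U_p)`,
`m = #orientations`): the PRODUCT LAW (PL)(iv) of `PolymerRarity.rarity_of_polymerLaw` for the scale-zero polymers
«plaquette `p` is `ε`-large», with activity `≈ β^{D₁/m} e^{−βε/m}`.  Proof: infvol-p3's sharp hereditary rarity
`OddTorusChessboard.measureReal_forall_le_cellAction_le_pow_rep_sharp` with singleton cells and Chebyshev parameter
`λ = β`. [folklore: Fröhlich–Israel–Lieb–Simon (1978) §5] -/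
theorem productLaw_largePlaquettes (r : LatticeRep G) :
    ∃ K₀ : ℝ, ∃ D₁ : ℕ, ∀ {M : ℕ} [NeZero M], Odd M → 3 ≤ M → ∀ β : ℝ, 1 ≤ β →
      ∀ (ε : ℝ) (A : Finset (Plaquette 4 M)),
        (wilsonMeasure (d := 4) (L := M) r.ρ β).real (⋂ p ∈ A, {U | ε ≤ plaquetteCost r.ρ U p}) ≤
          ∏ _p ∈ A, Real.exp (-(β * ε) / Fintype.card (Orient 4) +
            (K₀ + D₁ * Real.log β) / Fintype.card (Orient 4)) := by
  classical
  obtain ⟨K₀, D₁, h⟩ := measureReal_forall_le_cellAction_le_pow_rep_sharp (G := G) r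
  refine ⟨K₀, D₁, ?_⟩
  intro M _ hM hM3 β hβ ε A
  have h1 := h hM hM3 β hβ β (by linarith) le_rfl A (fun p => ({p} : Finset (Plaquette 4 M)))
    (fun p _ p' _ hpp' => Finset.disjoint_singleton.2 hpp') 1 (fun p _ => by rw [Finset.card_singleton]) ε
  have hset : (⋂ p ∈ A, {U : GaugeConfig 4 M G | ε ≤ plaquetteCost r.ρ U p}) =
      {U : GaugeConfig 4 M G | ∀ p ∈ A, ε ≤ ∑ q ∈ ({p} : Finset (Plaquette 4 M)), plaquetteCost r.ρ U q} := by
    ext U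
    simp only [Set.mem_iInter, Set.mem_setOf_eq, Finset.sum_singleton]
  rw [hset, Finset.prod_const]
  refine h1.trans (le_of_eq ?_)
  simp

/-! ## §2 Multiplicative rarity of plaquette-influence super-level sets on every odd torus (unconditional) -/

/-- **Scale-zero multiplicative rarity, unconditionally, on every odd torus.**  For every lattice representation `r`
(constants `K₀, D₁` of §1, `δ = exp(−βε/m + (K₀ + D₁ log β)/m)`): on every odd torus `M ≥ 3`, `β ≥ 1`, for influence
coefficients `c_{ip} ≥ 0` over torus plaquettes with `Σ_{i∈T} c_{ip} ≤ Λ` and `Σ_{p∈A} c_{ip} δ ≤ W`, `λ ≥ 0`, and every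
threshold `θ`, the plaquette-influence functionals `I_i = Σ_{p∈A} c_{ip} 1[ε ≤ φ_p]` satisfy
`μ_{M,β}(⋂_{i∈T} {θ ≤ I_i}) ≤ exp(λ e^{λΛ} W − λθ)^{#T}` — p527372's `measureReal_biInter_le_pow_of_polymerLaw` with its
product law discharged by §1.  No reflection positivity beyond the plaquette scale, no divisibility of `M`. [folklore] -/
theorem measureReal_biInter_plaquetteInfluence_le_pow (r : LatticeRep G) :
    ∃ K₀ : ℝ, ∃ D₁ : ℕ, ∀ {M : ℕ} [NeZero M], Odd M → 3 ≤ M → ∀ β : ℝ, 1 ≤ β →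
      ∀ (ε : ℝ) {ι : Type} (T : Finset ι) (A : Finset (Plaquette 4 M)) (c : ι → Plaquette 4 M → ℝ)
        (lam Λ W θ : ℝ), (∀ i ∈ T, ∀ p ∈ A, 0 ≤ c i p) → 0 ≤ lam → (∀ p ∈ A, ∑ i ∈ T, c i p ≤ Λ) →
        (∀ i ∈ T, ∑ p ∈ A, c i p * Real.exp (-(β * ε) / Fintype.card (Orient 4) +
          (K₀ + D₁ * Real.log β) / Fintype.card (Orient 4)) ≤ W) →
        (wilsonMeasure (d := 4) (L := M) r.ρ β).real
            (⋂ i ∈ T, {U | θ ≤ ∑ p ∈ A, c i p *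
              {U : GaugeConfig 4 M G | ε ≤ plaquetteCost r.ρ U p}.indicator (fun _ => (1 : ℝ)) U}) ≤
          (Real.exp (lam * Real.exp (lam * Λ) * W - lam * θ)) ^ T.card := by
  obtain ⟨K₀, D₁, h⟩ := productLaw_largePlaquettes (G := G) r
  refine ⟨K₀, D₁, ?_⟩
  intro M _ hM hM3 β hβ ε ι T A c lam Λ W θ hc hlam hΛ hW
  haveI : SecondCountableTopology G :=
    (r.continuous.isClosedEmbedding r.injective).isEmbedding.secondCountableTopology
  haveI := isProbabilityMeasure_wilsonMeasure (d := 4) (L := M) r.ρ r.continuous β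
  have hE : ∀ p : Plaquette 4 M, MeasurableSet {U : GaugeConfig 4 M G | ε ≤ plaquetteCost r.ρ U p} := fun p =>
    measurableSet_le measurable_const (measurable_plaquetteCost r.ρ r.continuous p)
  exact measureReal_biInter_le_pow_of_polymerLaw (wilsonMeasure (d := 4) (L := M) r.ρ β) T A
    (fun p => {U : GaugeConfig 4 M G | ε ≤ plaquetteCost r.ρ U p}) hE (fun _ => Real.exp (-(β * ε) /
      Fintype.card (Orient 4) + (K₀ + D₁ * Real.log β) / Fintype.card (Orient 4))) (fun _ _ => (Real.exp_pos _).le)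
    c hc θ hlam hΛ hW (fun B hB => h hM hM3 β hβ ε B)

/-! ## §3 The lifted form: clause (iv) of (PL) for scale-zero polymers in the route's vocabulary -/

omit [IsTopologicalGroup G] [CompactSpace G] [MeasurableSpace G] [BorelSpace G] in
/-- The scale-zero polymer event of a plaquette `q` of `ℤ⁴` read on the periodic lift of a torus configuration is the
torus event «the projected plaquette is `ε`-large». [folklore] -/
theorem indicator_largePlaquetteZd_torusLift (r : LatticeRep G) (M : ℕ) (ε : ℝ) (q : ZdPlaquette 4)
    (V : GaugeConfig 4 M G) :
    {η : LGConfig 4 G | ε ≤ (r.N : ℝ) - plaquetteObs r.ρ q.1 q.2.1.1 q.2.1.2 η}.indicator (fun _ => (1 : ℝ))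
        (torusLift M V) =
      {U : GaugeConfig 4 M G | ε ≤ plaquetteCost r.ρ U (Torus.proj M q.1, q.2)}.indicator (fun _ => (1 : ℝ)) V := by
  have hval : (r.N : ℝ) - plaquetteObs r.ρ q.1 q.2.1.1 q.2.1.2 (torusLift M V) =
      plaquetteCost r.ρ V (Torus.proj M q.1, q.2) := by
    rw [plaquetteObs, FreeEnergy.plaquetteHolonomyZd_torusLift]
    rfl
  classical
  simp only [Set.indicator_apply, Set.mem_setOf_eq, hval]

/-- **Clause (iv) of (PL) at scale zero, DISCHARGED on every odd torus of the route.**  For every lattice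
representation `r` (constants `K₀, D₁` of §1): for `1 ≤ L`, `β ≥ 1`, every threshold `ε` and every finite set `A` of
plaquettes of `ℤ⁴` based in the fundamental box `[−L, L]⁴`,
`torusE_{2L+1,β}(∏_{q∈A} 1_{E_q}) ≤ ∏_{q∈A} exp(−βε/m + (K₀ + D₁ log β)/m)` with the scale-zero polymer events
`E_q = {η | ε ≤ N − Re tr r(η_{∂q})}` — the product law `PolymerRarity.rarity_of_polymerLaw` asks, verbatim, for these
polymers.  Proof: read the events on the torus (`indicator_largePlaquetteZd_torusLift`), the projection is injective on
the box (`torusProj_injOn_box_of_lt`), §1. [folklore] -/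
theorem torusE_prod_indicator_largePlaquetteZd_le (r : LatticeRep G) :
    ∃ K₀ : ℝ, ∃ D₁ : ℕ, ∀ (L : ℕ), 1 ≤ L → ∀ β : ℝ, 1 ≤ β → ∀ (ε : ℝ) (A : Finset (ZdPlaquette 4)),
      (∀ q ∈ A, q.1 ∈ box 4 L) →
        torusE G r β L (fun U => ∏ q ∈ A,
          {η : LGConfig 4 G | ε ≤ (r.N : ℝ) - plaquetteObs r.ρ q.1 q.2.1.1 q.2.1.2 η}.indicator
            (fun _ => (1 : ℝ)) U) ≤
          ∏ _q ∈ A, Real.exp (-(β * ε) / Fintype.card (Orient 4) +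
            (K₀ + D₁ * Real.log β) / Fintype.card (Orient 4)) := by
  classical
  obtain ⟨K₀, D₁, h⟩ := productLaw_largePlaquettes (G := G) r
  refine ⟨K₀, D₁, ?_⟩
  intro L hL β hβ ε A hA
  haveI : SecondCountableTopology G :=
    (r.continuous.isClosedEmbedding r.injective).isEmbedding.secondCountableTopology
  haveI := isProbabilityMeasure_wilsonMeasure (d := 4) (L := 2 * L + 1) r.ρ r.continuous β
  set π : ZdPlaquette 4 → Plaquette 4 (2 * L + 1) := fun q => (Torus.proj (2 * L + 1) q.1, q.2) with hπ
  have hinj : Set.InjOn π A := by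
    intro q hq q' hq' hqq'
    simp only [hπ, Prod.mk.injEq] at hqq'
    exact Prod.ext (torusProj_injOn_box_of_lt (d := 4) (n := L) (L := 2 * L + 1) (by omega) (hA q hq) (hA q' hq')
      hqq'.1) hqq'.2
  have hE : ∀ p : Plaquette 4 (2 * L + 1),
      MeasurableSet {U : GaugeConfig 4 (2 * L + 1) G | ε ≤ plaquetteCost r.ρ U p} := fun p =>
    measurableSet_le measurable_const (measurable_plaquetteCost r.ρ r.continuous p)
  -- read on the torus, reindex over the projected plaquettes
  have hread : ∀ V : GaugeConfig 4 (2 * L + 1) G,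
      (∏ q ∈ A, {η : LGConfig 4 G | ε ≤ (r.N : ℝ) - plaquetteObs r.ρ q.1 q.2.1.1 q.2.1.2 η}.indicator
          (fun _ => (1 : ℝ)) (torusLift (2 * L + 1) V)) =
        ∏ p ∈ A.image π, {U : GaugeConfig 4 (2 * L + 1) G | ε ≤ plaquetteCost r.ρ U p}.indicator
          (fun _ => (1 : ℝ)) V := by
    intro V
    rw [Finset.prod_image hinj]
    exact Finset.prod_congr rfl fun q _ => indicator_largePlaquetteZd_torusLift r (2 * L + 1) ε q V
  have hodd : Odd (2 * L + 1) := odd_two_mul_add_one L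
  show ∫ V, (∏ q ∈ A, {η : LGConfig 4 G | ε ≤ (r.N : ℝ) - plaquetteObs r.ρ q.1 q.2.1.1 q.2.1.2 η}.indicator
      (fun _ => (1 : ℝ)) (torusLift (2 * L + 1) V)) ∂(wilsonMeasure (d := 4) (L := 2 * L + 1) r.ρ β) ≤ _
  simp_rw [hread]
  rw [integral_prod_indicator_eq_measureReal _ (A.image π) _ hE, Finset.prod_const,
    ← Finset.card_image_of_injOn hinj, ← Finset.prod_const]
  exact h hodd (by omega) β hβ ε (A.image π)

end PlaquetteScale

end Summit.QuantumFields.YangMills.Cruxes.UVSeamRec.PolymerRarity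

end
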